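import Summits.HodgeConjecture.CorCM.GaloisThirtyTwoCyclicEightTimesTwoCertificates
import Summits.HodgeConjecture.CorCM.GaloisThirtyTwoCentraliserExtensionId
import Summits.HodgeConjecture.CorCM.GaloisThirtyTwoCentraliserExtensionSwap
import Summits.HodgeConjecture.CorCM.TwoGroupCaseAPairNormalForm
import Summits.HodgeConjecture.CorCM.TwoGroupCaseACyclicEightNormalForm
import Summits.HodgeConjecture.CorCM.TwoGroupSquareInvolution
import Summits.HodgeConjecture.CorCM.TwoGroupTwoConjugateInvolution
import HarnessLib

/-!
# Case A of the order-`32` base is BAD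

COR-CM (cell `pub-hodgecm2`), binder seat b04 (gen 37), count-neutral own lane «Galois-CM-type classification».  KERNEL ONLY:
theorems; no definition, no named fact, no `sorry`.  `HC_CM` is neither used nor claimed.  ORDER-`32` BASE programme (A7-JUNCTION
gen-36 addendum §F–§G, gen-37 addendum).  `K` Galois CM of degree `32`, `c` = complex conjugation the ONLY central involution
of `Gal(K/ℚ)` («case A»: no proper Galois CM subfield), `Gal(K/ℚ)` non-abelian without elements of order `16`, with a second
involution and with a square outside `{1, c}`.  Then `K` has a primitive DEGENERATE CM type (`exists_simple_degenerate_of_caseA`):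

1. `g⁴ ∈ {1, c}` for all `g` (`CaseA.pow_four_eq_one_or_eq`);
2. an involution `t ∉ {1, c}` with exactly the two conjugates `t, tc` exists (`CaseA.exists_involution_two_conjugates` if some
   element has order `8`, `CaseA.exists_two_conjugates_of_sq` if the exponent is `4`);
3. `M = C(t)` has index `2`; either some `a ∈ M` has `a² ∉ N = ⟨t, c⟩` — then `M = C₈ × C₂` and family IA8
   (`CaseA.ia8_normal_form` + `exists_simple_degenerate_of_c8c2_action`) — or `M/N ≅ C₂²` and family CA2
   (`CaseA.pair_normal_form` + `exists_simple_degenerate_of_ca2_id` / `exists_simple_degenerate_of_ca2_swap`).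

## References

* [Shimura1998] G. Shimura, *Abelian Varieties with Complex Multiplication and Modular Functions*, §6.2 Thm. 3, §8.2 Prop. 26.
* [Gordon1999HodgeAVSurvey] B. B. Gordon, *A survey of the Hodge conjecture for abelian varieties*, Thm. 6.4, §9.3.
* [Rotman1995] J. J. Rotman, *An Introduction to the Theory of Groups*, 4th ed., GTM 148, Thm. 4.3, Cor. 5.45, Thm. 5.46.
-/

noncomputable section

open CategoryTheory CategoryTheory.Limits NumberField
open scoped BigOperators

namespace Summit.HodgeConjecture.CorCM.GaloisModels

open Literature.NumberTheory.ComplexMultiplication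
open Literature.AlgebraicGeometry.Motives (AbelianVariety CMType)
open Literature.AlgebraicGeometry.HodgeTheory
open Literature.AlgebraicGeometry.ComplexMultiplication (IsCMTypeRealisation)
open Literature.AlgebraicGeometry.Pohlmann1968
open Literature.Barriers.HodgeConjecture (divisorClassesSpan)
open Summit.HodgeConjecture.CorCM.GaloisRank

section Field

variable {K : Type} [Field K] [NumberField K] [IsCMField K] [IsGalois ℚ K]

/-- In a non-abelian group of order `32` without elements of order `16`, every element satisfies `g⁸ = 1`. [folklore] -/
theorem pow_eight_eq_one_of_card_thirtytwo {G : Type*} [Group G] [Finite G] (hcard : Nat.card G = 32)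
    (h16 : ∀ g : G, orderOf g ≠ 16) (hnab : ∃ g h : G, g * h ≠ h * g) (g : G) : g ^ 8 = 1 := by
  classical
  have hdvd : orderOf g ∣ 2 ^ 5 := by
    rw [show (2 : ℕ) ^ 5 = 32 by norm_num, ← hcard]; exact orderOf_dvd_natCard g
  obtain ⟨k, hk5, hk⟩ := (Nat.dvd_prime_pow Nat.prime_two).1 hdvd
  have hk4 : k ≠ 4 := fun h => h16 g (by rw [hk, h]; norm_num)
  have hk5' : k ≠ 5 := by
    intro h
    -- `g` generates `G`, so `G` is abelian
    obtain ⟨g₀, h₀, hgh⟩ := hnab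
    have htop : Subgroup.zpowers g = ⊤ := by
      apply Subgroup.eq_top_of_card_eq
      rw [Nat.card_zpowers, hk, h, hcard]; norm_num
    have hmem : ∀ y : G, ∃ i : ℤ, g ^ i = y := fun y => by
      have : y ∈ Subgroup.zpowers g := by rw [htop]; exact Subgroup.mem_top y
      exact Subgroup.mem_zpowers_iff.1 this
    obtain ⟨i, rfl⟩ := hmem g₀
    obtain ⟨j, rfl⟩ := hmem h₀
    exact hgh (by rw [← zpow_add, ← zpow_add, add_comm])
  have hk3 : k ≤ 3 := by omega
  obtain ⟨m, hm⟩ : ∃ m, 8 = orderOf g * m := by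
    rw [hk]
    interval_cases k
    · exact ⟨8, by norm_num⟩
    · exact ⟨4, by norm_num⟩
    · exact ⟨2, by norm_num⟩
    · exact ⟨1, by norm_num⟩
  rw [hm, pow_mul, pow_orderOf_eq_one, one_pow]

set_option maxHeartbeats 800000 in
/-- **CASE A IS BAD.**  `K` Galois CM of degree `32`; complex conjugation `c` is the only central involution of `Gal(K/ℚ)`; there is
another involution; no automorphism has order `16`; `Gal(K/ℚ)` is not abelian; some square lies outside `{1, c}`.  Then `K` has a
primitive DEGENERATE CM type (a simple CM abelian `16`-fold with an exceptional Hodge class on a power).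
[cite: Shimura1998, §6.2 Thm. 3 and §8.2 Prop. 26] [cite: Gordon1999HodgeAVSurvey, Thm. 6.4 and §9.3] [cite: Rotman1995, Thm. 4.3 and Cor. 5.45] -/
theorem exists_simple_degenerate_of_caseA (hdeg : Module.finrank ℚ K = 32)
    (hmin : ∀ s : K ≃ₐ[ℚ] K, s * s = 1 → (∀ g : K ≃ₐ[ℚ] K, g * s = s * g) →
      s = 1 ∨ s = (IsCMField.complexConj K).restrictScalars ℚ)
    (hinv : ∃ s : K ≃ₐ[ℚ] K, s * s = 1 ∧ s ≠ 1 ∧ s ≠ (IsCMField.complexConj K).restrictScalars ℚ)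
    (h16 : ∀ g : K ≃ₐ[ℚ] K, orderOf g ≠ 16) (hnab : ∃ g h : K ≃ₐ[ℚ] K, g * h ≠ h * g)
    (hsq : ∃ g : K ≃ₐ[ℚ] K, g * g ≠ 1 ∧ g * g ≠ (IsCMField.complexConj K).restrictScalars ℚ) :
    ∃ (Φ : CMType K) (φ : K →+* ℂ) (X : AbelianVariety ℂ) (ι : 𝓞 K →+* End X)
      (ϑ : K →+* Module.End ℂ (complexBetti X.X 1)),
      IsPrimitive (ℂ ≃+* ℂ) Φ.1 φ ∧ ¬ IsNondegenerate Φ ∧ IsCMTypeRealisation Φ X ι ϑ ∧ X.IsSimple ∧ X.dim = 16 ∧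
      ∃ m p : ℕ, ∃ z : complexBetti (⨁ fun _ : Fin m => X).X (2 * p), IsRationalClass z ∧
        IsOfHodgeType (⨁ fun _ : Fin m => X).dim (⨁ fun _ : Fin m => X).X (2 * p) p p z ∧
        z ∉ divisorClassesSpan (⨁ fun _ : Fin m => X).X (⨁ fun _ : Fin m => X).dim p := by
  classical
  set c := (IsCMField.complexConj K).restrictScalars ℚ with hcdef
  have hcc : c * c = 1 := model_complexConj_mul_self (MulEquiv.refl (K ≃ₐ[ℚ] K)) (by simp [hcdef])
  have hc1 : c ≠ 1 := model_complexConj_ne_one (MulEquiv.refl (K ≃ₐ[ℚ] K)) (by simp [hcdef])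
  have hcen : ∀ g : K ≃ₐ[ℚ] K, c * g = g * c := fun g =>
    model_complexConj_comm (MulEquiv.refl (K ≃ₐ[ℚ] K)) (by simp [hcdef]) g
  have hcard : Nat.card (K ≃ₐ[ℚ] K) = 32 := by
    rw [Nat.card_eq_fintype_card, card_model_eq_finrank (MulEquiv.refl (K ≃ₐ[ℚ] K)), hdeg]
  -- (1) exponent `8` and `g⁴ ∈ {1, c}`
  have hexp : ∀ g : K ≃ₐ[ℚ] K, g ^ 8 = 1 := pow_eight_eq_one_of_card_thirtytwo hcard h16 hnab
  have hp4 : ∀ g : K ≃ₐ[ℚ] K, g ^ 4 = 1 ∨ g ^ 4 = c := CaseA.pow_four_eq_one_or_eq hcard hcc hc1 hcen hmin hexp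
  -- a non-central involution
  have hnci : ∃ u : K ≃ₐ[ℚ] K, u * u = 1 ∧ ∃ y : K ≃ₐ[ℚ] K, y * u ≠ u * y := by
    obtain ⟨s, hss, hs1, hsc⟩ := hinv
    refine ⟨s, hss, ?_⟩
    by_contra hall
    push Not at hall
    rcases hmin s hss hall with h | h
    · exact hs1 h
    · exact hsc h
  -- (2) an involution with two conjugates
  obtain ⟨t, x, htt, ht1, htc, hxt, hconj⟩ : ∃ t x : K ≃ₐ[ℚ] K, t * t = 1 ∧ t ≠ 1 ∧ t ≠ c ∧ x * t * x⁻¹ = t * c ∧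
      ∀ g : K ≃ₐ[ℚ] K, g * t * g⁻¹ = t ∨ g * t * g⁻¹ = t * c := by
    by_cases h8 : ∃ a : K ≃ₐ[ℚ] K, orderOf a = 8
    · obtain ⟨a, ha⟩ := h8
      exact CaseA.exists_involution_two_conjugates hcard hc1 hcen hmin hp4 ha hnci
    · push Not at h8
      obtain ⟨g, hg1, hgc⟩ := hsq
      have hg4 : g ^ 4 = 1 := by
        rcases hp4 g with h | h
        · exact h
        · exfalso
          -- `g⁴ = c ≠ 1`, `g⁸ = 1`: `g` has order `8`
          haveI : Fact (Nat.Prime 2) := ⟨Nat.prime_two⟩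
          have h1 : ¬ g ^ 2 ^ 2 = 1 := by rw [show (2 : ℕ) ^ 2 = 4 by norm_num, h]; exact hc1
          have h2 : g ^ 2 ^ (2 + 1) = 1 := by simpa using hexp g
          exact h8 g (by simpa using orderOf_eq_prime_pow h1 h2)
      obtain ⟨x, hx, hconj⟩ := CaseA.exists_two_conjugates_of_sq hcard hcc hc1 hcen hmin hg4 hg1 hgc
      refine ⟨g * g, x, ?_, hg1, hgc, hx, hconj⟩
      rw [show g * g * (g * g) = g ^ 4 by simp only [pow_succ, pow_zero, one_mul, mul_assoc]]; exact hg4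
  -- (3) the dichotomy on `M = C(t)`
  by_cases hIA : ∃ a : K ≃ₐ[ℚ] K, a * t = t * a ∧ a * a ≠ 1 ∧ a * a ≠ t ∧ a * a ≠ c ∧ a * a ≠ t * c
  · -- family IA8
    obtain ⟨a, hat, hsq4⟩ := hIA
    obtain ⟨μ, σ, τ, ha8, ha4, hta, htza, hxC, hxa, hxu, hxx, hadm⟩ :=
      CaseA.ia8_normal_form hcard hcc hc1 hcen hmin hp4 hxt hconj htt ht1 htc hat hsq4
    exact exists_simple_degenerate_of_c8c2_action hdeg μ σ τ hadm a t x ha8 ha4.symm htt hta htza hxC hxa hxu hxx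
  · -- family CA2
    have hN2 : ∀ m : K ≃ₐ[ℚ] K, m * t = t * m → m * m = 1 ∨ m * m = t ∨ m * m = c ∨ m * m = t * c := by
      intro m hm
      by_contra h
      push Not at h
      exact hIA ⟨m, hm, h.1, h.2.1, h.2.2.1, h.2.2.2⟩
    rcases CaseA.pair_normal_form hcard hcc hc1 hcen hxt hconj htt ht1 htc hN2 with
      ⟨α₂, β₂, γ₂, e₅, a, b, y, hat, hbt, ha, hb, haa, hbb, hba, hyt, hya, hyb, hyy⟩ |
      ⟨α₁, α₂, γ₂, ε, a, b, y, hat, hbt, ha, hb, haa, hbb, hba, hyt, hya, hyb, hyy⟩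
    · exact exists_simple_degenerate_of_ca2_id hdeg α₂ β₂ γ₂ e₅ t a b y htt ht1 htc hat hbt ha hb haa hbb hba hyt hya
        hyb hyy
    · exact exists_simple_degenerate_of_ca2_swap hdeg α₁ α₂ γ₂ ε t a b y htt ht1 htc hat hbt ha hb haa hbb hba hyt hya
        hyb hyy

end Field

end Summit.HodgeConjecture.CorCM.GaloisModels

end
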